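import Literature.NumberTheory.Automorphic.AdelicPrimitiveVectorNormalForm
import Literature.NumberTheory.Automorphic.MirabolicEisensteinConvergence
import Literature.NumberTheory.Automorphic.AdeleRingTopology
import Literature.NumberTheory.Automorphic.AdicCompletionCompact
import Literature.NumberTheory.GaloisRepresentations.ClosureValuation
import Literature.Analysis.FunctionSpaces.GaussianSchwartz
import Mathlib.Analysis.InnerProductSpace.PiL2
import HarnessLib

/-!
# Convergence of the height zeta function `Σ_{ξ ∈ ℙ^{n−1}(K)} h(ξ g)^{−τ}` for `τ > n`: the spherical Godement section is `h^{−s}`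

Topic `NumberTheory/Automorphic`; namespace `Literature.NumberTheory.Automorphic` (sequel of `AdelicPrimitiveVectorNormalForm`,
`MirabolicEisensteinConvergence`).  KERNEL only: proved theorems, no definition, no named fact.

For a number field `K`, `n ≥ 1`, `g ∈ GL_n(𝔸_K)` and the Godement–Garrett height `h = vecHeight K` of `AdelicVectorHeight`
(`h(ξ g)` depends only on the line `K ξ`, product formula):

* §1 (`lintegral_section_eq_vecHeight_rpow_mul`) **the absolute Godement–Tate section of a `K`-SPHERICAL test function IS a
  power of the height**: for `Φ : 𝔸_Kⁿ → ℂ` invariant under the standard maximal compact subgroup `K = K_∞ · GL_n(𝒪̂_K)`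
  (`Φ(y k) = Φ(y)`), any right-invariant measure `ν` on `𝔸_Kˣ` and any real `t`,
  `∫⁻ ‖Φ(a · ξ g)‖ |a|^t dν(a) = h(ξ g)^{−t} · ∫⁻ ‖Φ(a · eₙ)‖ |a|^t dν(a)` (`ξ ∈ Kⁿ ∖ 0`) — by the normal form
  `ξ g = b · (eₙ k)`, `h(ξ g) = |b|` of ★ `AdelicPrimitiveVectorNormalForm` and the substitution `a ↦ a b⁻¹`
  ([Garrett2018, §2.2 and Thm. 2.2.2: heights and their `K`-invariance; GodementJacquetLNM260, §11: the Godement section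
  `∫ Φ(a e g)|a|^{ns} d×a` of the mirabolic Eisenstein series]);
* §2 (`exists_spherical_adelicSchwartzBruhat`) **a `K`-spherical Schwartz–Bruhat function exists**: `Φ₀ = (⊗_{w∣∞} Gaussian_w)
  ⊗ 𝟙_{𝒪̂ⁿ} ∈ 𝒮(𝔸_Kⁿ)` (★ `isStandardSchwartzBruhat_mul_indicator` with the tree's `gaussianSchwartz`), `K`-invariant because it
  factors through the local heights (`vecArchNorm`, `vecFinHeight`, which are `K`-invariant: ★ `AdelicVectorHeightCompact`), and
  `Φ₀(eₙ) ≠ 0`; hence (`lintegral_section_single_last_pos`) its section at `eₙ` is `> 0` for a Haar measure;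
* §3 (`summable_vecHeight_rpow_neg`) **THE HEIGHT ZETA FUNCTION CONVERGES**: `Σ_{[ξ] ∈ ℙ^{n−1}(K)} h(ξ g)^{−τ} < ∞` for every
  `τ > n` and every `g ∈ GL_n(𝔸_K)` — from §1–§2 and the absolute convergence of the mirabolic Eisenstein series
  ★ `summable_mirabolicEisenstein_holds` ([JacquetShalikaAJM1981, §4]; [CogdellAnalyticTheory2004, §2.3 p. 210]) applied to `Φ₀`
  at `s = τ ∕ n > 1`: the Eisenstein majorant `Σ_ξ ∫ |Φ₀(a ξ g)| |a|^{n re s}` IS `c₀ · Σ_ξ h(ξ g)^{−τ}`.  (Classically: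
  `#{ξ ∈ ℙ^{n−1}(K) : h ≤ B} ≍ B^{n}`, Schanuel; the minimal-parabolic Eisenstein series `E_s(g) = Σ_γ h(eₙ γ g)^{−s}` converges
  absolutely for `re s > n`, [Garrett2018, §3.3].)

Consumer: the absolute convergence of the rank-one doubling ∕ Siegel Eisenstein series on `U(W ⊕ W⁻)`, `dim W = 1`, in Weil's
range `N > 2` (`n = 2`, `τ = N`), piece SW2a (3) CONV of the E-2 Siegel–Weil child of the Hodge-CM cell `pub/hodgecm-mathlib`
(floor 0, line `F0_P4AdmissibleOccursInH1`; seat F0P4-p08, 2026-08-31).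

## References

* [Garrett2018] P. Garrett, *Modern Analysis of Automorphic Forms by Example* (2018), §2.2 (PDF pp. 81–82), Thm. 2.2.2, §3.3.
* [GodementJacquetLNM260] R. Godement, H. Jacquet, *Zeta functions of simple algebras*, LNM 260 (1972), §11.
* [JacquetShalikaAJM1981] H. Jacquet, J. A. Shalika, Amer. J. Math. 103 (1981), §4.
* [CogdellAnalyticTheory2004] J. W. Cogdell, *Analytic theory of L-functions for GL_n* (2004), §2.3, p. 210.
-/

noncomputable section

open scoped NNReal ENNReal Matrix
open NumberField IsDedekindDomain MeasureTheory Matrix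
open Literature.NumberTheory.GaloisRepresentations (mem_adicCompletionIntegers_iff_norm_le_one)

namespace Literature.NumberTheory.Automorphic

/-! ## §1 The absolute section of a `K`-spherical test function is `h^{−t}` times its value at `eₙ` -/

section Section

variable (K : Type) [Field K] [NumberField K] {m : ℕ}
variable [MeasurableSpace (AdeleRing (𝓞 K) K)] [BorelSpace (AdeleRing (𝓞 K) K)]

/-- **spherical section = `h^{−t}`**: for `Φ` invariant under `K = K_∞ · GL_n(𝒪̂_K)` acting on row vectors, a right-invariant
`ν` on `𝔸_Kˣ`, `t ∈ ℝ`, `ξ ∈ Kⁿ ∖ 0` and `g ∈ GL_n(𝔸_K)`: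
`∫⁻ ‖Φ(a · ξ g)‖ |a|^t dν = h(ξ g)^{−t} · ∫⁻ ‖Φ(a · eₙ)‖ |a|^t dν` (normal form `ξ g = b · eₙ k`, `h(ξ g) = |b|`, substitution
`a ↦ a b⁻¹`). [cite: Garrett2018, §2.2 (PDF pp. 81–82) and Thm. 2.2.2; GodementJacquetLNM260, §11] -/
theorem lintegral_section_eq_vecHeight_rpow_mul (ν : Measure (GaloisRepresentations.ideleGroup K)) [ν.IsMulRightInvariant]
    {Φ : (Fin (m + 1) → AdeleRing (𝓞 K) K) → ℂ}
    (hK : ∀ k ∈ standardMaximalCompactGL (m + 1) K, ∀ y : Fin (m + 1) → AdeleRing (𝓞 K) K,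
      Φ (y ᵥ* (k : Matrix (Fin (m + 1)) (Fin (m + 1)) (AdeleRing (𝓞 K) K))) = Φ y)
    (t : ℝ) {ξ : Fin (m + 1) → K} (hξ : ξ ≠ 0) (g : GL (Fin (m + 1)) (AdeleRing (𝓞 K) K)) :
    ∫⁻ a, ‖Φ ((a : AdeleRing (𝓞 K) K) • (ratVec K ξ ᵥ* (g : Matrix (Fin (m + 1)) (Fin (m + 1)) (AdeleRing (𝓞 K) K))))‖ₑ *
        ENNReal.ofReal ((IdeleClassGroup.ideleNorm K a : ℝ) ^ t) ∂ν =
      ENNReal.ofReal ((vecHeight K (ratVec K ξ ᵥ* (g : Matrix (Fin (m + 1)) (Fin (m + 1)) (AdeleRing (𝓞 K) K))) : ℝ) ^ (-t)) *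
        ∫⁻ a, ‖Φ ((a : AdeleRing (𝓞 K) K) • Pi.single (Fin.last m) (1 : AdeleRing (𝓞 K) K))‖ₑ *
          ENNReal.ofReal ((IdeleClassGroup.ideleNorm K a : ℝ) ^ t) ∂ν := by
  haveI := borelSpace_ideleGroup K
  obtain ⟨b, k, hk, hx, hh⟩ := exists_ratVec_vecMul_eq_units_smul_vecMul_and_vecHeight_eq K hξ g
  rw [hh, hx]
  set e : Fin (m + 1) → AdeleRing (𝓞 K) K := Pi.single (Fin.last m) 1 with he
  -- the integrand at `a` is `G (a * b) * |b|^{-t}` with `G c = ‖Φ(c • eₙ)‖ |c|^t`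
  set G : GaloisRepresentations.ideleGroup K → ℝ≥0∞ := fun c =>
    ‖Φ ((c : AdeleRing (𝓞 K) K) • e)‖ₑ * ENNReal.ofReal ((IdeleClassGroup.ideleNorm K c : ℝ) ^ t) with hG
  have hb0 : 0 < (IdeleClassGroup.ideleNorm K b : ℝ) := NNReal.coe_pos.2 (pos_iff_ne_zero.2 (ideleNorm_ne_zero b))
  have hpt : ∀ a : GaloisRepresentations.ideleGroup K,
      ‖Φ ((a : AdeleRing (𝓞 K) K) • ((b : AdeleRing (𝓞 K) K) •
          (e ᵥ* (k : Matrix (Fin (m + 1)) (Fin (m + 1)) (AdeleRing (𝓞 K) K)))))‖ₑ *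
        ENNReal.ofReal ((IdeleClassGroup.ideleNorm K a : ℝ) ^ t) =
      G (a * b) * ENNReal.ofReal ((IdeleClassGroup.ideleNorm K b : ℝ) ^ (-t)) := by
    intro a
    have ha0 : 0 ≤ (IdeleClassGroup.ideleNorm K a : ℝ) := NNReal.coe_nonneg _
    have hsmul : (a : AdeleRing (𝓞 K) K) • ((b : AdeleRing (𝓞 K) K) •
        (e ᵥ* (k : Matrix (Fin (m + 1)) (Fin (m + 1)) (AdeleRing (𝓞 K) K)))) =
        (((a * b : GaloisRepresentations.ideleGroup K) : AdeleRing (𝓞 K) K) • e) ᵥ*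
          (k : Matrix (Fin (m + 1)) (Fin (m + 1)) (AdeleRing (𝓞 K) K)) := by
      rw [smul_smul, Units.val_mul, Matrix.smul_vecMul]
    rw [hsmul, hK k hk, hG]
    dsimp only
    rw [mul_assoc, ← ENNReal.ofReal_mul (Real.rpow_nonneg (NNReal.coe_nonneg _) _), map_mul, NNReal.coe_mul,
      Real.mul_rpow ha0 hb0.le, mul_assoc, ← Real.rpow_add hb0, add_neg_cancel, Real.rpow_zero, mul_one]
  simp_rw [hpt]
  rw [lintegral_mul_const' _ _ ENNReal.ofReal_ne_top, lintegral_mul_right_eq_self G b, mul_comm]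

end Section

/-! ## §2 A `K`-spherical Schwartz–Bruhat function with non-vanishing section -/

section Spherical

variable (K : Type) [Field K] [NumberField K]

/-- the finite local height bound `h_v(y) ≤ 1 ∀ v` says that every finite coordinate is a local integer. [folklore] -/
private theorem forall_vecFinHeight_le_one_iff {n : ℕ} (y : Fin n → AdeleRing (𝓞 K) K) :
    (∀ v : HeightOneSpectrum (𝓞 K), vecFinHeight K v y ≤ 1) ↔
      ∀ (i : Fin n) (v : HeightOneSpectrum (𝓞 K)), (y i).2 v ∈ v.adicCompletionIntegers K := by
  constructor
  · intro h i v
    rw [mem_adicCompletionIntegers_iff_norm_le_one]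
    have hv := h v
    rw [vecFinHeight, Finset.sup_le_iff] at hv
    exact_mod_cast hv i (Finset.mem_univ i)
  · intro h v
    rw [vecFinHeight, Finset.sup_le_iff]
    intro i _
    have hi := (mem_adicCompletionIntegers_iff_norm_le_one (K := K) v ((y i).2 v)).1 (h i v)
    exact_mod_cast hi

/-- the square of the `w`-Euclidean norm is the sum of the squared coordinate norms. [folklore] -/
private theorem coe_vecArchNorm_sq {n : ℕ} (w : InfinitePlace K) (y : Fin n → AdeleRing (𝓞 K) K) :
    ((vecArchNorm K w y : ℝ≥0) : ℝ) ^ 2 = ∑ i, ‖(y i).1 w‖ ^ 2 := by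
  rw [vecArchNorm, ← NNReal.coe_pow, NNReal.sq_sqrt, NNReal.coe_sum]
  refine Finset.sum_congr rfl fun i _ => ?_
  rw [NNReal.coe_pow, coe_nnnorm]

/-- **A `K`-SPHERICAL SCHWARTZ–BRUHAT FUNCTION EXISTS**: `Φ₀ = (⊗_{w∣∞} e^{−‖·‖_w²}) ⊗ 𝟙_{𝒪̂ⁿ} ∈ 𝒮(𝔸_Kⁿ)` is invariant under the
row action of `K = K_∞ · GL_n(𝒪̂_K)` (it factors through the `K`-invariant local heights) and does not vanish at `eₙ`.
[cite: Garrett2018, §2.2 (PDF p. 81) and Claim 3.3.2; GodementJacquetLNM260, §11] -/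
theorem exists_spherical_adelicSchwartzBruhat (m : ℕ) :
    ∃ Φ₀ : (Fin (m + 1) → AdeleRing (𝓞 K) K) → ℂ, Φ₀ ∈ adelicSchwartzBruhat K (m + 1) ∧
      (∀ k ∈ standardMaximalCompactGL (m + 1) K, ∀ y : Fin (m + 1) → AdeleRing (𝓞 K) K,
        Φ₀ (y ᵥ* (k : Matrix (Fin (m + 1)) (Fin (m + 1)) (AdeleRing (𝓞 K) K))) = Φ₀ y) ∧
      Φ₀ (Pi.single (Fin.last m) (1 : AdeleRing (𝓞 K) K)) ≠ 0 := by
  classical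
  -- the finite part: the integral box `𝒪̂ⁿ`, compact and clopen
  set U : Set (Fin (m + 1) → FiniteAdeleRing (𝓞 K) K) :=
    {z | ∀ (i : Fin (m + 1)) (v : HeightOneSpectrum (𝓞 K)), z i v ∈ v.adicCompletionIntegers K} with hU
  have hUpi : U = Set.univ.pi fun _ : Fin (m + 1) =>
      {t : FiniteAdeleRing (𝓞 K) K | ∀ v : HeightOneSpectrum (𝓞 K), t v ∈ v.adicCompletionIntegers K} := by
    ext z
    simp only [hU, Set.mem_setOf_eq, Set.mem_univ_pi]
  haveI : ∀ v : HeightOneSpectrum (𝓞 K), CompactSpace (v.adicCompletionIntegers K) :=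
    compactSpace_adicCompletionIntegers' K
  have hUc : IsCompact U := by
    rw [hUpi]
    exact isCompact_univ_pi fun _ => FiniteAdeleRing.isCompact_setOf_forall_mem (𝓞 K) K
  have hUo : IsOpen U := by
    rw [hUpi]
    exact isOpen_set_pi Set.finite_univ fun _ _ => FiniteAdeleRing.isOpen_setOf_forall_mem (𝓞 K) K
  haveI : T2Space (FiniteAdeleRing (𝓞 K) K) := inferInstanceAs <| T2Space
    (RestrictedProduct (fun v : HeightOneSpectrum (𝓞 K) => v.adicCompletion K)
      (fun v => (v.adicCompletionIntegers K : Set (v.adicCompletion K))) Filter.cofinite)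
  have hUcl : IsClopen U := ⟨hUc.isClosed, hUo⟩
  -- the archimedean part: Gaussians in the Euclidean norms
  set Gr : SchwartzMap (Fin (m + 1) → ℝ) ℂ :=
    SchwartzMap.compCLMOfContinuousLinearEquiv ℝ (EuclideanSpace.equiv (Fin (m + 1)) ℝ).symm
      (Literature.Analysis.FunctionSpaces.gaussianSchwartz (EuclideanSpace ℝ (Fin (m + 1))) 1) with hGr
  set Gc : SchwartzMap (Fin (m + 1) → ℂ) ℂ :=
    SchwartzMap.compCLMOfContinuousLinearEquiv ℝ (PiLp.continuousLinearEquiv 2 ℝ (fun _ : Fin (m + 1) => ℂ)).symm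
      (Literature.Analysis.FunctionSpaces.gaussianSchwartz (EuclideanSpace ℂ (Fin (m + 1))) 1) with hGc
  have hGr_apply : ∀ x : Fin (m + 1) → ℝ, Gr x = ((Real.exp (-(∑ i, x i ^ 2)) : ℝ) : ℂ) := by
    intro x
    rw [hGr, SchwartzMap.compCLMOfContinuousLinearEquiv_apply, Function.comp_apply,
      Literature.Analysis.FunctionSpaces.gaussianSchwartz_apply one_pos, EuclideanSpace.norm_eq]
    congr 1
    rw [Real.sq_sqrt (Finset.sum_nonneg fun i _ => sq_nonneg _), neg_mul, one_mul]
    congr 1; congr 1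
    refine Finset.sum_congr rfl fun i _ => ?_
    simp [Real.norm_eq_abs, sq_abs]
  have hGc_apply : ∀ z : Fin (m + 1) → ℂ, Gc z = ((Real.exp (-(∑ i, ‖z i‖ ^ 2)) : ℝ) : ℂ) := by
    intro z
    rw [hGc, SchwartzMap.compCLMOfContinuousLinearEquiv_apply, Function.comp_apply,
      Literature.Analysis.FunctionSpaces.gaussianSchwartz_apply one_pos, EuclideanSpace.norm_eq]
    congr 1
    rw [Real.sq_sqrt (Finset.sum_nonneg fun i _ => sq_nonneg _), neg_mul, one_mul]
    rfl
  set Φ₀ : (Fin (m + 1) → AdeleRing (𝓞 K) K) → ℂ := fun x =>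
    archSchwartzFun K (m + 1) (fun _ => Gr) (fun _ => Gc) (vecInfinitePart K (m + 1) x) *
      U.indicator 1 (vecFinitePart K (m + 1) x) with hΦ₀
  -- `Φ₀` factors through the local heights
  have hformula : ∀ y : Fin (m + 1) → AdeleRing (𝓞 K) K, Φ₀ y =
      ((∏ w : {w : InfinitePlace K // w.IsReal}, ((Real.exp (-(((vecArchNorm K w.1 y : ℝ≥0) : ℝ) ^ 2)) : ℝ) : ℂ)) *
        ∏ w : {w : InfinitePlace K // w.IsComplex}, ((Real.exp (-(((vecArchNorm K w.1 y : ℝ≥0) : ℝ) ^ 2)) : ℝ) : ℂ)) *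
      (if ∀ v : HeightOneSpectrum (𝓞 K), vecFinHeight K v y ≤ 1 then 1 else 0) := by
    intro y
    rw [hΦ₀]
    dsimp only
    congr 1
    · rw [archSchwartzFun]
      congr 1
      · refine Finset.prod_congr rfl fun w _ => ?_
        rw [hGr_apply, coe_vecArchNorm_sq]
        have hs : ∑ i, ((vecInfinitePart K (m + 1) y i).1 w) ^ 2 = ∑ i, ‖(y i).1 w.1‖ ^ 2 := by
          refine Finset.sum_congr rfl fun i _ => ?_
          rw [vecInfinitePart_apply, InfiniteAdeleRing.ringEquiv_mixedSpace_apply]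
          dsimp only
          rw [← sq_abs, ← Real.norm_eq_abs,
            (AddMonoidHomClass.isometry_iff_norm _).1
              (NumberField.InfinitePlace.Completion.isometry_extensionEmbeddingOfIsReal w.2)]
        rw [hs]
      · refine Finset.prod_congr rfl fun w _ => ?_
        rw [hGc_apply, coe_vecArchNorm_sq]
        have hs : ∑ i, ‖(vecInfinitePart K (m + 1) y i).2 w‖ ^ 2 = ∑ i, ‖(y i).1 w.1‖ ^ 2 := by
          refine Finset.sum_congr rfl fun i _ => ?_
          rw [vecInfinitePart_apply, InfiniteAdeleRing.ringEquiv_mixedSpace_apply]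
          dsimp only
          rw [(AddMonoidHomClass.isometry_iff_norm _).1
            (NumberField.InfinitePlace.Completion.isometry_extensionEmbedding w.1)]
        rw [hs]
    · by_cases hy : ∀ v : HeightOneSpectrum (𝓞 K), vecFinHeight K v y ≤ 1
      · rw [if_pos hy, Set.indicator_of_mem, Pi.one_apply]
        rw [hU, Set.mem_setOf_eq]
        exact (forall_vecFinHeight_le_one_iff K y).1 hy
      · rw [if_neg hy, Set.indicator_of_notMem]
        rw [hU, Set.mem_setOf_eq]
        exact fun h => hy ((forall_vecFinHeight_le_one_iff K y).2 h)
  refine ⟨Φ₀, ?_, ?_, ?_⟩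
  · exact (isStandardSchwartzBruhat_mul_indicator (fun _ => Gr) (fun _ => Gc) hUcl hUc).mem_adelicSchwartzBruhat
  · intro k hk y
    rw [hformula, hformula]
    simp_rw [vecArchNorm_vecMul_of_mem_standardMaximalCompactGL hk, vecFinHeight_vecMul_of_mem_standardMaximalCompactGL hk]
  · rw [hformula]
    have hfin : ∀ v : HeightOneSpectrum (𝓞 K), vecFinHeight K v (Pi.single (Fin.last m) (1 : AdeleRing (𝓞 K) K)) ≤ 1 := by
      intro v
      have h := vecFinHeight_single (K := K) v (Fin.last m) (1 : AdeleRing (𝓞 K) K)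
      rw [h]
      have h1 : ((1 : AdeleRing (𝓞 K) K).2) v = 1 := rfl
      rw [h1, nnnorm_one]
    rw [if_pos hfin, mul_one]
    refine mul_ne_zero (Finset.prod_ne_zero_iff.2 fun w _ => ?_) (Finset.prod_ne_zero_iff.2 fun w _ => ?_) <;>
      exact_mod_cast (Real.exp_pos _).ne'

variable {m : ℕ}
variable [MeasurableSpace (AdeleRing (𝓞 K) K)] [BorelSpace (AdeleRing (𝓞 K) K)]

/-- **the spherical section at `eₙ` is positive**: for a continuous `Φ` with `Φ(eₙ) ≠ 0`, a Haar measure `ν` on `𝔸_Kˣ` and any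
real `t`, `0 < ∫⁻ ‖Φ(a · eₙ)‖ |a|^t dν(a)` (the integrand is continuous, positive at `a = 1`, and `ν` charges open sets).
[cite: GodementJacquetLNM260, §11] -/
theorem lintegral_section_single_last_pos (ν : Measure (GaloisRepresentations.ideleGroup K)) [ν.IsHaarMeasure]
    {Φ : (Fin (m + 1) → AdeleRing (𝓞 K) K) → ℂ} (hΦc : Continuous Φ)
    (hΦ : Φ (Pi.single (Fin.last m) (1 : AdeleRing (𝓞 K) K)) ≠ 0) (t : ℝ) :
    0 < ∫⁻ a, ‖Φ ((a : AdeleRing (𝓞 K) K) • Pi.single (Fin.last m) (1 : AdeleRing (𝓞 K) K))‖ₑ *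
      ENNReal.ofReal ((IdeleClassGroup.ideleNorm K a : ℝ) ^ t) ∂ν := by
  haveI := borelSpace_ideleGroup K
  set e : Fin (m + 1) → AdeleRing (𝓞 K) K := Pi.single (Fin.last m) 1 with he
  -- the real-valued integrand `fr a = ‖Φ(a eₙ)‖ |a|^t` is continuous and positive at `a = 1`
  set fr : GaloisRepresentations.ideleGroup K → ℝ := fun a =>
    ‖Φ ((a : AdeleRing (𝓞 K) K) • e)‖ * (IdeleClassGroup.ideleNorm K a : ℝ) ^ t with hfr
  have hfrc : Continuous fr := by
    have h1 : Continuous fun a : GaloisRepresentations.ideleGroup K => Φ ((a : AdeleRing (𝓞 K) K) • e) :=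
      hΦc.comp (Units.continuous_val.smul continuous_const)
    have h2 : Continuous fun a : GaloisRepresentations.ideleGroup K => (IdeleClassGroup.ideleNorm K a : ℝ) ^ t := by
      refine Continuous.rpow_const (NNReal.continuous_coe.comp (continuous_ideleNorm_holds K)) fun a => Or.inl ?_
      exact (NNReal.coe_pos.2 (pos_iff_ne_zero.2 (ideleNorm_ne_zero a))).ne'
    exact h1.norm.mul h2
  have hf_eq : ∀ a : GaloisRepresentations.ideleGroup K,
      ‖Φ ((a : AdeleRing (𝓞 K) K) • e)‖ₑ * ENNReal.ofReal ((IdeleClassGroup.ideleNorm K a : ℝ) ^ t) =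
        ENNReal.ofReal (fr a) := by
    intro a
    rw [hfr]
    dsimp only
    rw [ENNReal.ofReal_mul (norm_nonneg _), ofReal_norm]
  have hfr1 : 0 < fr 1 := by
    rw [hfr]
    dsimp only
    rw [Units.val_one, one_smul, map_one, NNReal.coe_one, Real.one_rpow, mul_one]
    exact norm_pos_iff.2 hΦ
  -- on the open set `V = {fr > fr(1)/2} ∋ 1` the integrand exceeds the constant `fr(1)/2`
  set c : ℝ := fr 1 / 2 with hc
  have hc0 : 0 < c := half_pos hfr1
  have hcf : c < fr 1 := half_lt_self hfr1
  set V : Set (GaloisRepresentations.ideleGroup K) := {a | c < fr a} with hV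
  have hVo : IsOpen V := isOpen_lt continuous_const hfrc
  have hV1 : (1 : GaloisRepresentations.ideleGroup K) ∈ V := hcf
  have hνV : 0 < ν V := hVo.measure_pos ν ⟨1, hV1⟩
  simp_rw [hf_eq]
  calc (0 : ℝ≥0∞) < ENNReal.ofReal c * ν V := ENNReal.mul_pos (ENNReal.ofReal_pos.2 hc0).ne' hνV.ne'
    _ = ∫⁻ a, V.indicator (fun _ => ENNReal.ofReal c) a ∂ν := (lintegral_indicator_const hVo.measurableSet _).symm
    _ ≤ ∫⁻ a, ENNReal.ofReal (fr a) ∂ν := lintegral_mono fun a => by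
        by_cases ha : a ∈ V
        · rw [Set.indicator_of_mem ha]; exact ENNReal.ofReal_le_ofReal (le_of_lt ha)
        · rw [Set.indicator_of_notMem ha]; exact bot_le

end Spherical

/-! ## §3 The height zeta function `Σ_{[ξ]} h(ξ g)^{−τ}` converges for `τ > n` -/

section Summable

variable (K : Type) [Field K] [NumberField K] {m : ℕ}

/-- **CONVERGENCE OF THE HEIGHT ZETA FUNCTION ∕ MINIMAL-PARABOLIC EISENSTEIN MAJORANT**: for every `g ∈ GL_n(𝔸_K)` (`n = m + 1 ≥ 1`)
and every real `τ > n`, `Σ_{[ξ] ∈ ℙ^{n−1}(K)} h(ξ g)^{−τ} < ∞`, `h = vecHeight K` the Godement–Garrett height (independent of the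
representative `ξ` of the line).  Proof: for the `K`-spherical `Φ₀ ∈ 𝒮(𝔸_Kⁿ)` of §2 and a Haar measure on `𝔸_Kˣ`, the absolute
Eisenstein majorant `Σ_{[ξ]} ∫ |Φ₀(a ξ g)| |a|^{τ} d×a`, finite by ★ `summable_mirabolicEisenstein_holds` at `s = τ∕n > 1`
[JacquetShalikaAJM1981, §4], equals `c₀ · Σ_{[ξ]} h(ξ g)^{−τ}` with `c₀ > 0` (§1, §2).
[cite: JacquetShalikaAJM1981, §4; Garrett2018, §2.2 Thm. 2.2.2 and §3.3; CogdellAnalyticTheory2004, §2.3 p. 210] -/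
theorem summable_vecHeight_rpow_neg (g : GL (Fin (m + 1)) (AdeleRing (𝓞 K) K)) {τ : ℝ} (hτ : (m + 1 : ℝ) < τ) :
    Summable fun p : Projectivization K (Fin (m + 1) → K) =>
      ((vecHeight K (ratVec K p.rep ᵥ* (g : Matrix (Fin (m + 1)) (Fin (m + 1)) (AdeleRing (𝓞 K) K))) : ℝ≥0) : ℝ) ^ (-τ) := by
  letI : MeasurableSpace (AdeleRing (𝓞 K) K) := borel _
  haveI : BorelSpace (AdeleRing (𝓞 K) K) := ⟨rfl⟩
  obtain ⟨ν, hν⟩ := exists_isHaarMeasure_ideleGroup K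
  obtain ⟨Φ₀, hΦ₀, hKinv, hΦ₀e⟩ := exists_spherical_adelicSchwartzBruhat K m
  obtain ⟨hcont, hfin⟩ := continuous_and_tsum_lintegral_lt_top_of_mem K ν hΦ₀
  have hn0 : (0 : ℝ) < (m + 1 : ℝ) := by positivity
  set σ : ℝ := τ / (m + 1 : ℝ) with hσ
  have hσ1 : 1 < σ := by rw [hσ, lt_div_iff₀ hn0, one_mul]; exact hτ
  have hτ' : ((m + 1 : ℕ) : ℝ) * σ = τ := by
    rw [hσ]; push_cast; field_simp
  have htot := hfin σ hσ1 g
  rw [hτ'] at htot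
  -- the constant `c₀ = ∫⁻ ‖Φ₀(a eₙ)‖ |a|^τ dν > 0`
  set c₀ : ℝ≥0∞ := ∫⁻ a, ‖Φ₀ ((a : AdeleRing (𝓞 K) K) • Pi.single (Fin.last m) (1 : AdeleRing (𝓞 K) K))‖ₑ *
    ENNReal.ofReal ((IdeleClassGroup.ideleNorm K a : ℝ) ^ τ) ∂ν with hc₀
  have hc₀pos : 0 < c₀ := lintegral_section_single_last_pos K ν hcont hΦ₀e τ
  -- each term of the Eisenstein majorant is `h^{-τ} · c₀`
  have hterm : ∀ p : Projectivization K (Fin (m + 1) → K),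
      ∫⁻ a, (‖Φ₀ ((a : AdeleRing (𝓞 K) K) •
          (ratVec K p.rep ᵥ* (g : Matrix (Fin (m + 1)) (Fin (m + 1)) (AdeleRing (𝓞 K) K))))‖ₑ : ℝ≥0∞) *
        ENNReal.ofReal ((IdeleClassGroup.ideleNorm K a : ℝ) ^ τ) ∂ν =
      ENNReal.ofReal (((vecHeight K (ratVec K p.rep ᵥ*
          (g : Matrix (Fin (m + 1)) (Fin (m + 1)) (AdeleRing (𝓞 K) K))) : ℝ≥0) : ℝ) ^ (-τ)) * c₀ :=
    fun p => lintegral_section_eq_vecHeight_rpow_mul K ν hKinv τ p.rep_nonzero g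
  simp_rw [hterm] at htot
  rw [ENNReal.tsum_mul_right] at htot
  have hsum : ∑' p : Projectivization K (Fin (m + 1) → K),
      ENNReal.ofReal (((vecHeight K (ratVec K p.rep ᵥ*
        (g : Matrix (Fin (m + 1)) (Fin (m + 1)) (AdeleRing (𝓞 K) K))) : ℝ≥0) : ℝ) ^ (-τ)) ≠ ⊤ :=
    (ENNReal.lt_top_of_mul_ne_top_left htot.ne hc₀pos.ne').ne
  have h := ENNReal.summable_toReal hsum
  refine h.congr fun p => ?_
  exact ENNReal.toReal_ofReal (Real.rpow_nonneg (NNReal.coe_nonneg _) _)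

end Summable

end Literature.NumberTheory.Automorphic
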